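import Summits.ValiantsHypothesis.ValiantsHypothesis.Theorems.DivisionGapZeroOneTransferStubFormulaGridProjectionAux4

/-!
# Crux `DivisionGap.ZeroOneTransfer` (stmt-ValiantsHypothesis-5066), line `planar-dimer-sign-elimination` —
stub `stub_formulaGridProjection`, support file 6: the weights of the PARALLEL layout, and the
bridge to the route's encoding

* `parX`, `parW`, `parTau` — the data of the parallel composition `x • F + y • G` in the grid
  (used by files 7–9): `parX r c hF m x y` is the frame-and-wire dart weight at `(r, c)` for an
  `hF × m` upper gadget (`x` on `p → pF`, `y` on `p → pG`, unit on every other frame/wire dart,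
  `0` elsewhere; made irreducible after its unfolding lemma, so that elaboration never opens the
  case distinction), `parW` adds the two gadget weights, `parTau` is the domino tiling of the
  leftover cells.  In/out vertex splitting of Datta–Kulkarni–Limaye–Mahajan 2010 §4.4 on Valiant's
  1979 §2 parallel composition.
* `msum_box_eq_routeSum` — for dart weights on `ℕ × ℕ` supported on adjacent cells, the matching sum
  (file 1) of the `N × N` square is VERBATIM the route's involution sum over `Fin N × Fin N` with
  its adjacency conjunct, read through the coordinate embedding (`msum_map`, `invols_univ`).

Registered sub-goal proved here: `stub_formulaGridProjection_routeBridge`. [folklore]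
-/

set_option linter.dupNamespace false

namespace Summit.ValiantsHypothesis.ValiantsHypothesis.Theorems.DivisionGapZeroOneTransfer

namespace FormulaGridProjection

open Finset MvPolynomial

/-- `TwoState⟦D, W, p, q, g⟧` (a LOCAL NOTATION, deliberately not a definition): a TWO-STATE GADGET on the
vertex set `D` with ports `p ≠ q` computing `g` — the whole of `D` has matching sum `g` ("active": both
ports matched inside), `D ∖ {p, q}` has matching sum `1` ("inactive"), and `|D|` is even (so the two
mixed states have matching sum `0` by parity).  The two-attachment case of a gadget signature
(Valiant 1979 §2; DKLM 2010 §4.4). -/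
local notation3 "TwoState⟦" D ", " W ", " p ", " q ", " g "⟧" =>
  p ∈ D ∧ q ∈ D ∧ p ≠ q ∧ Even (Finset.card D) ∧ msum D W = g ∧
    msum (Finset.erase (Finset.erase D p) q) W = 1


/-- `IsLab⟦x⟧` (local notation): `x` is literally a variable `X j` or a constant `C c` — the entries
allowed in a Valiant projection (`IsProjection`). -/
local notation3 "IsLab⟦" x "⟧" => (∃ j, x = MvPolynomial.X j) ∨ ∃ c, x = MvPolynomial.C c

/-- `Adj⟦a, b⟧` (local notation): adjacency of the square grid on `ℕ × ℕ`, verbatim the four disjuncts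
of the route's grid-dimer polynomial. -/
local notation3 "Adj⟦" a ", " b "⟧" =>
  (Prod.fst a + 1 = Prod.fst b ∧ Prod.snd a = Prod.snd b) ∨
    (Prod.fst b + 1 = Prod.fst a ∧ Prod.snd a = Prod.snd b) ∨
    (Prod.fst a = Prod.fst b ∧ Prod.snd a + 1 = Prod.snd b) ∨
    (Prod.fst a = Prod.fst b ∧ Prod.snd b + 1 = Prod.snd a)

/-- `box⟦r, c, h, w⟧` (local notation): the `h × w` rectangle of cells with top-left cell `(r, c)`
(rows `r ≤ i < r + h`, columns `c ≤ j < c + w`). -/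
local notation3 "box⟦" r ", " c ", " h ", " w "⟧" =>
  (Finset.Ico r (r + h) ×ˢ Finset.Ico c (c + w) : Finset (ℕ × ℕ))

/-- `Gad⟦W, r, c, h, w, g⟧` (local notation): `W` is a GRID GADGET for `g` on the rectangle
`box⟦r, c, h, w⟧` — every dart weight is a label, non-zero weights only on darts between adjacent
cells of the rectangle, and the rectangle is a two-state gadget computing `g` with ports its
top-left and top-right cells. -/
local notation3 "Gad⟦" W ", " r ", " c ", " h ", " w ", " g "⟧" =>
  (∀ a b, IsLab⟦W a b⟧) ∧ (∀ a b, W a b ≠ 0 → a ∈ box⟦r, c, h, w⟧ ∧ b ∈ box⟦r, c, h, w⟧ ∧ Adj⟦a, b⟧) ∧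
    TwoState⟦box⟦r, c, h, w⟧, W, (r, c), (r, c + w - 1), g⟧

section ParDefs

variable {R : Type*} [CommSemiring R] {ι : Type*}

/-- The FRAME-AND-WIRE dart weights of the parallel layout at `(r, c)` for an `hF × m` upper gadget
and coefficients `x`, `y`: `x` on `p → pF`, `y` on `p → pG`, `1` on the reverse darts, on the edges
`q — qF`, `q — qG`, `pF — P_F`, `qF — Q_F`, on the two side-column chains from `pG`/`qG` down to
row `r+1+hF` and on their junctions with the ports of the lower gadget; `0` elsewhere. [folklore] -/
noncomputable def parX (r c hF m : ℕ) (x y : MvPolynomial ι R) : ℕ × ℕ → ℕ × ℕ → MvPolynomial ι R := fun u v =>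
      if u.1 = r ∧ u.2 = c ∧ v.1 = r ∧ v.2 = c + 1 then x else
      if u.1 = r ∧ u.2 = c ∧ v.1 = r + 1 ∧ v.2 = c then y else
      if ((u.1 = r ∧ u.2 = c + 1 ∧ v.1 = r ∧ v.2 = c) ∨
        (u.1 = r + 1 ∧ u.2 = c ∧ v.1 = r ∧ v.2 = c) ∨
        (u.1 = r ∧ v.1 = r ∧ ((u.2 = c + m + 1 ∧ v.2 = c + m) ∨ (u.2 = c + m ∧ v.2 = c + m + 1))) ∨
        (u.2 = c + m + 1 ∧ v.2 = c + m + 1 ∧ ((u.1 = r ∧ v.1 = r + 1) ∨ (u.1 = r + 1 ∧ v.1 = r))) ∨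
        (u.2 = c + 1 ∧ v.2 = c + 1 ∧ ((u.1 = r ∧ v.1 = r + 1) ∨ (u.1 = r + 1 ∧ v.1 = r))) ∨
        (u.2 = c + m ∧ v.2 = c + m ∧ ((u.1 = r ∧ v.1 = r + 1) ∨ (u.1 = r + 1 ∧ v.1 = r))) ∨
        (u.2 = c ∧ v.2 = c ∧ r + 1 ≤ u.1 ∧ r + 1 ≤ v.1 ∧ u.1 ≤ r + 1 + hF ∧ v.1 ≤ r + 1 + hF ∧
          (u.1 + 1 = v.1 ∨ v.1 + 1 = u.1)) ∨
        (u.2 = c + m + 1 ∧ v.2 = c + m + 1 ∧ r + 1 ≤ u.1 ∧ r + 1 ≤ v.1 ∧ u.1 ≤ r + 1 + hF ∧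
          v.1 ≤ r + 1 + hF ∧ (u.1 + 1 = v.1 ∨ v.1 + 1 = u.1)) ∨
        (u.1 = r + 1 + hF ∧ v.1 = r + 1 + hF ∧
          ((u.2 = c ∧ v.2 = c + 1) ∨ (u.2 = c + 1 ∧ v.2 = c))) ∨
        (u.1 = r + 1 + hF ∧ v.1 = r + 1 + hF ∧
          ((u.2 = c + m + 1 ∧ v.2 = c + m) ∨ (u.2 = c + m ∧ v.2 = c + m + 1)))) then 1 else 0

/-- Unfolding `parX`. [folklore] -/
theorem parX_apply (r c hF m : ℕ) (x y : MvPolynomial ι R) (u v : ℕ × ℕ) :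
    parX r c hF m x y u v =
      if u.1 = r ∧ u.2 = c ∧ v.1 = r ∧ v.2 = c + 1 then x else
      if u.1 = r ∧ u.2 = c ∧ v.1 = r + 1 ∧ v.2 = c then y else
      if ((u.1 = r ∧ u.2 = c + 1 ∧ v.1 = r ∧ v.2 = c) ∨
        (u.1 = r + 1 ∧ u.2 = c ∧ v.1 = r ∧ v.2 = c) ∨
        (u.1 = r ∧ v.1 = r ∧ ((u.2 = c + m + 1 ∧ v.2 = c + m) ∨ (u.2 = c + m ∧ v.2 = c + m + 1))) ∨
        (u.2 = c + m + 1 ∧ v.2 = c + m + 1 ∧ ((u.1 = r ∧ v.1 = r + 1) ∨ (u.1 = r + 1 ∧ v.1 = r))) ∨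
        (u.2 = c + 1 ∧ v.2 = c + 1 ∧ ((u.1 = r ∧ v.1 = r + 1) ∨ (u.1 = r + 1 ∧ v.1 = r))) ∨
        (u.2 = c + m ∧ v.2 = c + m ∧ ((u.1 = r ∧ v.1 = r + 1) ∨ (u.1 = r + 1 ∧ v.1 = r))) ∨
        (u.2 = c ∧ v.2 = c ∧ r + 1 ≤ u.1 ∧ r + 1 ≤ v.1 ∧ u.1 ≤ r + 1 + hF ∧ v.1 ≤ r + 1 + hF ∧
          (u.1 + 1 = v.1 ∨ v.1 + 1 = u.1)) ∨
        (u.2 = c + m + 1 ∧ v.2 = c + m + 1 ∧ r + 1 ≤ u.1 ∧ r + 1 ≤ v.1 ∧ u.1 ≤ r + 1 + hF ∧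
          v.1 ≤ r + 1 + hF ∧ (u.1 + 1 = v.1 ∨ v.1 + 1 = u.1)) ∨
        (u.1 = r + 1 + hF ∧ v.1 = r + 1 + hF ∧
          ((u.2 = c ∧ v.2 = c + 1) ∨ (u.2 = c + 1 ∧ v.2 = c))) ∨
        (u.1 = r + 1 + hF ∧ v.1 = r + 1 + hF ∧
          ((u.2 = c + m + 1 ∧ v.2 = c + m) ∨ (u.2 = c + m ∧ v.2 = c + m + 1)))) then 1 else 0 := rfl

attribute [irreducible] parX

/-- The total dart weight of the parallel layout: the two gadgets plus the frame and wires.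
[folklore] -/
noncomputable def parW (WF WG : ℕ × ℕ → ℕ × ℕ → MvPolynomial ι R) (r c hF m : ℕ) (x y : MvPolynomial ι R) :
    ℕ × ℕ → ℕ × ℕ → MvPolynomial ι R := fun u v => WF u v + WG u v + parX r c hF m x y u v

/-- The domino tiling of the filler cells of the parallel layout: horizontal pairs in the middle of
row `r` and of the bottom row, vertical pairs in the two side columns below the wires. [folklore] -/
def parTau (r c hF hG m : ℕ) : ℕ × ℕ → ℕ × ℕ := fun v =>
    if v.1 = r then (v.1, if (v.2 + c) % 2 = 0 then v.2 + 1 else v.2 - 1)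
    else if v.1 = r + hF + hG + 1 ∧ c + 1 ≤ v.2 ∧ v.2 ≤ c + m then
      (v.1, if (v.2 + c) % 2 = 1 then v.2 + 1 else v.2 - 1)
    else (if (v.1 + r + hF) % 2 = 0 then v.1 + 1 else v.1 - 1, v.2)

/-- Unfolding `parTau`. [folklore] -/
theorem parTau_apply (r c hF hG m : ℕ) (v : ℕ × ℕ) : parTau r c hF hG m v =
    if v.1 = r then (v.1, if (v.2 + c) % 2 = 0 then v.2 + 1 else v.2 - 1)
    else if v.1 = r + hF + hG + 1 ∧ c + 1 ≤ v.2 ∧ v.2 ≤ c + m then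
      (v.1, if (v.2 + c) % 2 = 1 then v.2 + 1 else v.2 - 1)
    else (if (v.1 + r + hF) % 2 = 0 then v.1 + 1 else v.1 - 1, v.2) := rfl

end ParDefs

section Bridge

variable {R : Type*} [CommSemiring R] {ι : Type*}

/-- **Bridge to the route's encoding.** For dart weights on `ℕ × ℕ` supported on adjacent cells,
the matching sum of the `N × N` square is the route's involution sum over `Fin N × Fin N` (with its
adjacency conjunct) of the weights read through the coordinate embedding. [folklore] -/
theorem msum_box_eq_routeSum (N : ℕ) (W : ℕ × ℕ → ℕ × ℕ → MvPolynomial ι R)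
    (hsupp : ∀ a b, W a b ≠ 0 → Adj⟦a, b⟧) :
    msum box⟦0, 0, N, N⟧ W =
      ∑ f ∈ (Finset.univ : Finset (Fin N × Fin N → Fin N × Fin N)).filter (fun f => ∀ v, f (f v) = v ∧
        f v ≠ v ∧ (((v.1 : ℕ) + 1 = (f v).1 ∧ (v.2 : ℕ) = (f v).2) ∨ (((f v).1 : ℕ) + 1 = v.1 ∧
        (v.2 : ℕ) = (f v).2) ∨ ((v.1 : ℕ) = (f v).1 ∧ (v.2 : ℕ) + 1 = (f v).2) ∨
        ((v.1 : ℕ) = (f v).1 ∧ ((f v).2 : ℕ) + 1 = v.2))),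
        ∏ v : Fin N × Fin N, W ((v.1 : ℕ), (v.2 : ℕ)) (((f v).1 : ℕ), ((f v).2 : ℕ)) := by
  let φ : Fin N × Fin N ↪ ℕ × ℕ := ⟨fun v => ((v.1 : ℕ), (v.2 : ℕ)), fun v w h => by
    simp only [Prod.mk.injEq] at h
    exact Prod.ext (Fin.ext h.1) (Fin.ext h.2)⟩
  have hφ : ∀ v, φ v = ((v.1 : ℕ), (v.2 : ℕ)) := fun v => rfl
  have hbox : box⟦0, 0, N, N⟧ = (Finset.univ : Finset (Fin N × Fin N)).map φ := by
    ext v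
    rw [mem_box, Finset.mem_map]
    constructor
    · intro h
      exact ⟨(⟨v.1, by omega⟩, ⟨v.2, by omega⟩), Finset.mem_univ _, rfl⟩
    · rintro ⟨w, -, rfl⟩
      rw [hφ]
      exact ⟨Nat.zero_le _, by simp, Nat.zero_le _, by simp⟩
  rw [hbox, msum_map, msum, invols_univ]
  simp only [hφ]
  symm
  rw [show (Finset.univ : Finset (Fin N × Fin N → Fin N × Fin N)).filter (fun f => ∀ v, f (f v) = v ∧
        f v ≠ v ∧ (((v.1 : ℕ) + 1 = (f v).1 ∧ (v.2 : ℕ) = (f v).2) ∨ (((f v).1 : ℕ) + 1 = v.1 ∧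
        (v.2 : ℕ) = (f v).2) ∨ ((v.1 : ℕ) = (f v).1 ∧ (v.2 : ℕ) + 1 = (f v).2) ∨
        ((v.1 : ℕ) = (f v).1 ∧ ((f v).2 : ℕ) + 1 = v.2))) =
      ((Finset.univ : Finset (Fin N × Fin N → Fin N × Fin N)).filter
        (fun f => ∀ v, f (f v) = v ∧ f v ≠ v)).filter (fun f => ∀ v,
          (((v.1 : ℕ) + 1 = (f v).1 ∧ (v.2 : ℕ) = (f v).2) ∨ (((f v).1 : ℕ) + 1 = v.1 ∧
          (v.2 : ℕ) = (f v).2) ∨ ((v.1 : ℕ) = (f v).1 ∧ (v.2 : ℕ) + 1 = (f v).2) ∨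
          ((v.1 : ℕ) = (f v).1 ∧ ((f v).2 : ℕ) + 1 = v.2))) by
    ext f
    simp only [Finset.mem_filter, Finset.mem_univ, true_and]
    exact ⟨fun h => ⟨fun v => ⟨(h v).1, (h v).2.1⟩, fun v => (h v).2.2⟩,
      fun h v => ⟨(h.1 v).1, (h.1 v).2, h.2 v⟩⟩]
  apply Finset.sum_filter_of_ne
  intro f _ hne v
  by_contra hv
  apply hne
  apply Finset.prod_eq_zero (Finset.mem_univ v)
  by_contra h'
  exact hv (hsupp _ _ h')

end Bridge

end FormulaGridProjection

open Finset FormulaGridProjection in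
/-- **Registered sub-goal `stub_formulaGridProjection_routeBridge`** of `stub_formulaGridProjection`
(crux stmt-ValiantsHypothesis-5066, line `planar-dimer-sign-elimination`): the matching sum of the
`N × N` square of grid cells with dart weights supported on adjacent cells is verbatim the route's
grid-dimer involution sum (`FormulaGridProjection.msum_box_eq_routeSum`, notation expanded).
[folklore] -/
theorem stub_formulaGridProjection_routeBridge : ∀ (R : Type) [CommSemiring R] (ι : Type) (N : ℕ) (W : ℕ × ℕ → ℕ × ℕ → MvPolynomial ι R), (∀ a b, W a b ≠ 0 → ((Prod.fst a + 1 = Prod.fst b ∧ Prod.snd a = Prod.snd b) ∨ (Prod.fst b + 1 = Prod.fst a ∧ Prod.snd a = Prod.snd b) ∨ (Prod.fst a = Prod.fst b ∧ Prod.snd a + 1 = Prod.snd b) ∨ (Prod.fst a = Prod.fst b ∧ Prod.snd b + 1 = Prod.snd a))) → Summit.ValiantsHypothesis.ValiantsHypothesis.Theorems.DivisionGapZeroOneTransfer.FormulaGridProjection.msum (Finset.Ico 0 (0 + N) ×ˢ Finset.Ico 0 (0 + N)) W = ∑ f ∈ (Finset.univ : Finset (Fin N × Fin N → Fin N × Fin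 N)).filter (fun f => ∀ v, f (f v) = v ∧ f v ≠ v ∧ (((v.1 : ℕ) + 1 = (f v).1 ∧ (v.2 : ℕ) = (f v).2) ∨ (((f v).1 : ℕ) + 1 = v.1 ∧ (v.2 : ℕ) = (f v).2) ∨ ((v.1 : ℕ) = (f v).1 ∧ (v.2 : ℕ) + 1 = (f v).2) ∨ ((v.1 : ℕ) = (f v).1 ∧ ((f v).2 : ℕ) + 1 = v.2))), ∏ v : Fin N × Fin N, W ((v.1 : ℕ), (v.2 : ℕ)) (((f v).1 : ℕ), ((f v).2 : ℕ)) :=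
  fun _ _ _ N W hsupp => msum_box_eq_routeSum N W hsupp

end Summit.ValiantsHypothesis.ValiantsHypothesis.Theorems.DivisionGapZeroOneTransfer
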